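import Summits.BirchSwinnertonDyer.BirchSwinnertonDyer.Theorems.AdditiveBranchIMCMultLowerBudget
import Summits.BirchSwinnertonDyer.BirchSwinnertonDyer.Theorems.AdditiveBranchIMCMultLowerCongruence
import HarnessLib

/-!
# Crux child `MultLambdaLower` (item 19590) and crux `MultLower` (item 19359) BY NAME from EITHER per-pair
# instrument of cell (M): the record-and-budget datum (n1011 / EPW algebraic rank-partner road) OR a unit
# congruent partner (EPW analytic transfer road) OR the raw Λ-adic input — one statement

Cell `bsd-addord`, seat `bsd-addord-k1-c4` (D-0074 row B3), gen 3; one-screen sequel of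
`AdditiveBranchIMCMultLowerBudget` (p446207) and `AdditiveBranchIMCMultLowerCongruence` (p440698). HONEST FRAMING:
theorems only; all published inputs are named-fact binders (`hKW`, `hEPW`); the per-row data are displayed,
never asserted; closes nothing; BSD is not proved. PURPOSE: the planner's single reference for «what a per-pair
certificate on cell (M) buys toward 19590 / the rank-0 half of 19359», with the two certificate kinds of record
side by side: (A) X4(M) ∧ `ρ̄` onto ∧ record `Mult[Odd]FirstUnitIndexAt W p b` ∧ budget `BudgetLeLambdaAt p W b`
(free for `b ≤ rank`, else from a congruent partner of enough rank, `…Budget` §4 — reach measured by k1-c2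
kit j253895: 226/445 @5); (B) `p ≥ 5` ∧ a tower-surjective SEMISTABLE partner with UNIT branch `p`-adic
`L`-function and a `Γ_ℚ`-equivariant `V₁[p] ≃ V[p]` at every twist model (`…Congruence` §2 — reach ≤ 10/542
content rows, kit j254129, none inside the table, j254030/j254717); (C) the raw input.

References: Kato 2004 [Kato2004Asterisque]; Emerton–Pollack–Weston 2006 Thm. 3.3.3, Cor. 5.1.4
[EmertonPollackWeston2006]; Delbourgo 1998 Prop. 4 [Delbourgo1998]; Pal 2012 Thm. 3.2 [Pal2012]; Miller 2011
Def. 1.1 [Miller2011LMS].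
-/

set_option autoImplicit false
set_option linter.dupNamespace false

noncomputable section

open scoped Classical MatrixGroups ModularForm NumberField

open CongruenceSubgroup WeierstrassCurve
  Literature.NumberTheory.EllipticCurves
  Literature.NumberTheory.EllipticCurves.ModularForms
  Literature.NumberTheory.EllipticCurves.Rank1Residual
  Literature.NumberTheory.EllipticCurves.Rank1Residual.Typed
  Literature.NumberTheory.EllipticCurves.GreenbergVatsal2000
  Literature.NumberTheory.EllipticCurves.EmertonPollackWeston2006
  Literature.NumberTheory.GaloisRepresentations

namespace Summit.BirchSwinnertonDyer.BirchSwinnertonDyer.Theorems.AdditiveBranchIMCMultLowerBudget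

open Summit.BirchSwinnertonDyer.Rank1Residual
open Summit.BirchSwinnertonDyer.Rank1Residual.Additive
open Summit.BirchSwinnertonDyer.Rank1Residual.Additive.CensusQ6
open Summit.BirchSwinnertonDyer.Rank1Residual.AdditivePotMult
open Summit.BirchSwinnertonDyer.BirchSwinnertonDyer.Theses.AdditiveBranchIMC
open Summit.BirchSwinnertonDyer.BirchSwinnertonDyer.Theorems.AdditiveBranchIMCMultLower
open Summit.BirchSwinnertonDyer.BirchSwinnertonDyer.Theorems.AdditiveBranchIMCMultLowerCongruence

/-- **Item 19590 `MultLambdaLower` BY NAME from either per-pair instrument.** For every cell-(M) pair of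
analytic rank `≤ 1` and every globally minimal twist model `V` (`C • V^{(p*)} = W`), the Λ-adic input
`QuadraticBranchLowerDivisibilityAt V p` holds IF the row carries (A) the record-and-budget datum (n1011's
`…_of_budget'`), OR (B) at `p ≥ 5` a tower-surjective semistable partner `V₁` with unit branch `p`-adic
`L`-function and a `Γ_ℚ`-equivariant `V₁[p] ≃ V[p]` for every twist model (EPW Cor. 5.1.4 analytic transfer,
`quadraticBranchLowerDivisibilityAt_of_partner`), OR (C) the input outright. CONDITIONAL on `hRows` (not a
theorem); 19590 stays OPEN. [cite: Kato2004Asterisque, Thm. 12.5 (4) (p. 222), Thm. 17.4 (3) (p. 273)]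
[cite: EmertonPollackWeston2006, Cor. 5.1.4 (arXiv p30), Cor. 3.2.5 and Thm. 3.1.1] [cite: SkinnerUrban2014, Thm. 3.6.4 (shape only)] -/
theorem multLambdaLower_of_katoHalf_of_branchTransfer_of_rowData
    (hKW : Wuthrich2014.kato_halfEigenCharIdeal_dvd_cyclotomicPrime_of_surjective)
    (hEPW : EmertonPollackWeston2006.cor514_branchTransfer_semistable_of_torsionIso)
    (hRows : ∀ (W : WeierstrassCurve ℚ) [W.IsElliptic] [W.IsGloballyMinimal] (p : ℕ) [Fact p.Prime],
      N10.CellM W p → W.analyticRank ≤ 1 →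
      (ClassX4M W p ∧ Surj W p ∧ ∃ b : ℕ,
          ((p % 4 = 1 → MultFirstUnitIndexAt W p b) ∧ (p % 4 = 3 → MultOddFirstUnitIndexAt W p b)) ∧
            BudgetLeLambdaAt p W b) ∨
      (5 ≤ p ∧ ∃ (V₁ : WeierstrassCurve ℚ) (_ : V₁.IsElliptic) (_ : V₁.IsGloballyMinimal),
        (IsOrdinaryAt V₁ p ∨ V₁.HasMultiplicativeReductionAtPrime p) ∧
        (∀ n : ℕ, V₁.HasSurjectiveModNGaloisRep (p ^ n : ℕ)) ∧
        (∀ {N : ℕ} [NeZero N] (f : CuspForm (Gamma0 N) 2) (B : PowerSeries ℚ_[p]),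
          IsNewformOf V₁ f →
          ((IsOrdinaryAt V₁ p ∧
              B = if Even (p / 2) then padicLFunctionBranch f ((unitRoot V₁ p : ℤ_[p]) : ℚ_[p]) (p / 2)
                else padicLFunctionMinusBranch f ((unitRoot V₁ p : ℤ_[p]) : ℚ_[p]) (p / 2)) ∨
            (V₁.HasSplitMultiplicativeReductionAtPrime p ∧
              B = if Even (p / 2) then padicLFunctionPlusBranchMult f (1 : ℚ_[p]) (p / 2)
                else padicLFunctionMinusBranchMult f (1 : ℚ_[p]) (p / 2)) ∨
            (V₁.HasMultiplicativeReductionAtPrime p ∧ ¬ V₁.HasSplitMultiplicativeReductionAtPrime p ∧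
              B = if Even (p / 2) then padicLFunctionPlusBranchMult f (-1 : ℚ_[p]) (p / 2)
                else padicLFunctionMinusBranchMult f (-1 : ℚ_[p]) (p / 2))) →
          ∀ (ϖ : ℚ), (if Even (p / 2) then (ϖ : ℝ) * V₁.realPeriodRat = plusPeriod f
            else (ϖ : ℝ) * V₁.imaginaryPeriodRat = minusPeriod f) →
          ‖PowerSeries.constantCoeff (PowerSeries.C (ϖ : ℚ_[p]) * B)‖ = 1) ∧
        ∀ (V : WeierstrassCurve ℚ) [V.IsElliptic] [V.IsGloballyMinimal],
          (∃ C : VariableChange ℚ, C • V.quadraticTwist ((-1) ^ (p / 2) * p : ℚ) = W) →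
          ∃ e : geomTorsion V₁ (p : ℤ) ≃+ geomTorsion V (p : ℤ),
            ∀ (σ : Field.absoluteGaloisGroup ℚ) (P : geomTorsion V₁ (p : ℤ)), e (σ • P) = σ • e P) ∨
      (∀ (V : WeierstrassCurve ℚ) [V.IsElliptic] [V.IsGloballyMinimal],
          (∃ C : VariableChange ℚ, C • V.quadraticTwist ((-1) ^ (p / 2) * p : ℚ) = W) →
            QuadraticBranchLowerDivisibilityAt V p)) :
    MultLambdaLower := by
  intro W _ _ p _ hc hr V _ _ hCW
  rcases hRows W p hc hr with ⟨hX, hsurj, b, hrec, hbud⟩ | ⟨hp5, V₁, _, _, hred₁, hsurj₁, hunit₁, hiso⟩ | hraw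
  · exact hX.forall_quadraticBranchLowerDivisibilityAt_of_katoHalf_of_firstUnitIndex_of_budget' hKW hsurj
      hrec hbud V hCW
  · exact quadraticBranchLowerDivisibilityAt_of_partner hKW hEPW hp5 V₁ hred₁ hsurj₁ hunit₁ V (hiso V hCW)
  · exact hraw V hCW

/-- **The parent `MultLower` BY NAME from the same per-row data plus the rank-`1` children** (19591 Schneider
+ 19592 branch `p`-adic Gross–Zagier on (M), as the binder `hGZ` of gen 2's crux shape p426893).
CONDITIONAL on `hRows` and `hGZ`; closes nothing. [cite: Delbourgo1998, Main Conjecture (p. 151) (shape)]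
[cite: Delbourgo2002, Theorem (A), (B) (p. 40)] [cite: Kato2004Asterisque, Thm. 17.4 (3) (p. 273)]
[cite: EmertonPollackWeston2006, Cor. 5.1.4 (arXiv p30)] [cite: Miller2011LMS, Def. 1.1] -/
theorem multLower_of_facts_of_katoHalf_of_branchTransfer_of_rowData_of_rankOneInputs
    (hDelX : Delbourgo1998.prop4_rankZero_constantCoeff_eq_unit_mul_of_potMult)
    (hPal : Pal2012.thm32_sqrt_mul_realPeriodRat_twist_eq_of_prime_one_mod_four)
    (hDelM : Delbourgo2002.mainTheorem_potMult)
    (hGZK : rank_eq_analyticRank_of_analyticRank_le_one) (hmod : hasEntireLFunction_rat)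
    (hmodD : nonempty_modularParametrizationData)
    (hKW : Wuthrich2014.kato_halfEigenCharIdeal_dvd_cyclotomicPrime_of_surjective)
    (hEPW : EmertonPollackWeston2006.cor514_branchTransfer_semistable_of_torsionIso)
    (hRows : ∀ (W : WeierstrassCurve ℚ) [W.IsElliptic] [W.IsGloballyMinimal] (p : ℕ) [Fact p.Prime],
      N10.CellM W p → W.analyticRank ≤ 1 →
      (ClassX4M W p ∧ Surj W p ∧ ∃ b : ℕ,
          ((p % 4 = 1 → MultFirstUnitIndexAt W p b) ∧ (p % 4 = 3 → MultOddFirstUnitIndexAt W p b)) ∧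
            BudgetLeLambdaAt p W b) ∨
      (5 ≤ p ∧ ∃ (V₁ : WeierstrassCurve ℚ) (_ : V₁.IsElliptic) (_ : V₁.IsGloballyMinimal),
        (IsOrdinaryAt V₁ p ∨ V₁.HasMultiplicativeReductionAtPrime p) ∧
        (∀ n : ℕ, V₁.HasSurjectiveModNGaloisRep (p ^ n : ℕ)) ∧
        (∀ {N : ℕ} [NeZero N] (f : CuspForm (Gamma0 N) 2) (B : PowerSeries ℚ_[p]),
          IsNewformOf V₁ f →
          ((IsOrdinaryAt V₁ p ∧
              B = if Even (p / 2) then padicLFunctionBranch f ((unitRoot V₁ p : ℤ_[p]) : ℚ_[p]) (p / 2)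
                else padicLFunctionMinusBranch f ((unitRoot V₁ p : ℤ_[p]) : ℚ_[p]) (p / 2)) ∨
            (V₁.HasSplitMultiplicativeReductionAtPrime p ∧
              B = if Even (p / 2) then padicLFunctionPlusBranchMult f (1 : ℚ_[p]) (p / 2)
                else padicLFunctionMinusBranchMult f (1 : ℚ_[p]) (p / 2)) ∨
            (V₁.HasMultiplicativeReductionAtPrime p ∧ ¬ V₁.HasSplitMultiplicativeReductionAtPrime p ∧
              B = if Even (p / 2) then padicLFunctionPlusBranchMult f (-1 : ℚ_[p]) (p / 2)
                else padicLFunctionMinusBranchMult f (-1 : ℚ_[p]) (p / 2))) →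
          ∀ (ϖ : ℚ), (if Even (p / 2) then (ϖ : ℝ) * V₁.realPeriodRat = plusPeriod f
            else (ϖ : ℝ) * V₁.imaginaryPeriodRat = minusPeriod f) →
          ‖PowerSeries.constantCoeff (PowerSeries.C (ϖ : ℚ_[p]) * B)‖ = 1) ∧
        ∀ (V : WeierstrassCurve ℚ) [V.IsElliptic] [V.IsGloballyMinimal],
          (∃ C : VariableChange ℚ, C • V.quadraticTwist ((-1) ^ (p / 2) * p : ℚ) = W) →
          ∃ e : geomTorsion V₁ (p : ℤ) ≃+ geomTorsion V (p : ℤ),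
            ∀ (σ : Field.absoluteGaloisGroup ℚ) (P : geomTorsion V₁ (p : ℤ)), e (σ • P) = σ • e P) ∨
      (∀ (V : WeierstrassCurve ℚ) [V.IsElliptic] [V.IsGloballyMinimal],
          (∃ C : VariableChange ℚ, C • V.quadraticTwist ((-1) ^ (p / 2) * p : ℚ) = W) →
            QuadraticBranchLowerDivisibilityAt V p))
    (hGZ : ∀ (W : WeierstrassCurve ℚ) [W.IsElliptic] [W.IsGloballyMinimal] (p : ℕ) [Fact p.Prime],
      N10.CellM W p → W.analyticRank = 1 → ∀ Dh : PAdicHeightData W p, Delbourgo2002.LeadingTermClauses W p Dh →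
        SchneiderConjecture Dh ∧ BranchPAdicGrossZagierMultAt W p Dh) :
    MultLower :=
  multLower_of_facts_of_quadraticBranchLower_of_branchPAdicGrossZagierMult hDelX hPal hDelM hGZK hmod hmodD
    (fun W _ _ p _ hc hr V _ _ hCW =>
      multLambdaLower_of_katoHalf_of_branchTransfer_of_rowData hKW hEPW hRows W p hc hr V hCW)
    hGZ

end Summit.BirchSwinnertonDyer.BirchSwinnertonDyer.Theorems.AdditiveBranchIMCMultLowerBudget

end
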